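import Mathlib
import Summits.NavierStokesRegularity.NavierStokesRegularity.Theorems.L3TimeExponentPincerCritModulus
import HarnessLib.Audit
import HarnessLib

/-!
# L3TimeExponentPincer — step 0 of the (J) reduction: a blowing-up family from `¬ CritSmoothingNoSwirlB`

Support kernel for the crux `L3CascadeJaw` (item stmt-NavierStokesRegularity-19499) of route
`L3TimeExponentPincer`; the opening (pure logic) step of the compactness reduction
`CritSmoothingNoSwirlB ⇐ (SFL³)` of planner nsreg-p2's ROUND-12 §2b (blueprint attached to the
item): if NO velocity-indexed critical smoothing modulus exists in the swirl-free class
(`¬ CritSmoothingNoSwirlB`, `…Theorems.L3TimeExponentPincerCritModulus`), then at ONE datum size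
`A` there are Tao-class swirl-free axisymmetric solutions `u^k` with `‖u₀^k‖₃ ≤ A` and times
`t_k ∈ (0, T_k)` with `‖u^k(t_k)‖_∞ > k t_k^{-1/2}` — otherwise `A ↦ k(A)` would be a modulus.

* `exists_family_of_not_critSmoothingNoSwirlB` — the selection (choice over the negation);
* `exists_point_of_lt_eLpNorm_top` — an essential supremum above a level is exceeded at a point
  (so `k t_k^{-1/2} < ‖u^k(t_k, x_k)‖` for some `x_k`), the input of the translation step.

WHAT THIS IS NOT: not NS regularity; logic over an OPEN node (`CritSmoothingNoSwirlB` is neither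
asserted nor refuted); the crux `L3CascadeJaw` is untouched; no crux claim.
-/

noncomputable section

namespace Summit.NavierStokesRegularity.NavierStokesRegularity.Theorems.L3TimeExponentPincerCritModulusNoSwirlSelection

open MeasureTheory Set Filter Literature.Analysis.FluidPDE
open Summit.NavierStokesRegularity.NavierStokesRegularity.Theorems.L3TimeExponentPincerQuantJaw
open Summit.NavierStokesRegularity.NavierStokesRegularity.Theorems.L3TimeExponentPincerCritModulus
open scoped ENNReal NNReal

/-- **Step 0 of (J): selection of a blowing-up family.**  If `CritSmoothingNoSwirlB` fails, there
is `A ≥ 0` such that for every `k : ℕ` some Tao-class solution (`ν = 1`) from an axisymmetric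
swirl-free datum with `‖u₀‖₃ ≤ A` satisfies `‖u(t)‖_∞ > k · t^{-1/2}` at some time `t ∈ (0, T)`.
(Otherwise, choosing for each `A ≥ 0` a `k(A)` that bounds all of them defines a modulus
`Φ(A) = k(A)` with `CritSmoothingNoSwirl Φ`.) -/
theorem exists_family_of_not_critSmoothingNoSwirlB (h : ¬ CritSmoothingNoSwirlB) :
    ∃ A : ℝ, 0 ≤ A ∧ ∀ k : ℕ, ∃ (T : ℝ) (u₀ : E3 → E3) (u : ℝ → E3 → E3) (p : ℝ → E3 → ℝ) (t : ℝ),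
      0 < T ∧ IsTaoSolutionOn T 1 u₀ u p ∧ IsAxisymmetric u₀ ∧ HasNoSwirl u₀ ∧
      eLpNorm u₀ 3 volume ≤ ENNReal.ofReal A ∧ t ∈ Ioo 0 T ∧
      ENNReal.ofReal k * ENNReal.ofReal (t ^ (-(1 / 2 : ℝ))) < eLpNorm (u t) ∞ volume := by
  by_contra hcon
  apply h
  -- for every `A ≥ 0` some `k` bounds the whole class
  have hsel : ∀ A : ℝ, 0 ≤ A → ∃ k : ℕ, ∀ (T : ℝ) (u₀ : E3 → E3) (u : ℝ → E3 → E3)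
      (p : ℝ → E3 → ℝ) (t : ℝ), 0 < T → IsTaoSolutionOn T 1 u₀ u p → IsAxisymmetric u₀ →
      HasNoSwirl u₀ → eLpNorm u₀ 3 volume ≤ ENNReal.ofReal A → t ∈ Ioo 0 T →
      eLpNorm (u t) ∞ volume ≤ ENNReal.ofReal k * ENNReal.ofReal (t ^ (-(1 / 2 : ℝ))) := by
    intro A hA
    by_contra hk
    apply hcon
    refine ⟨A, hA, fun k => ?_⟩
    by_contra hnone
    apply hk
    refine ⟨k, fun T u₀ u p t hT hsol hax hns hA3 ht => ?_⟩
    by_contra hlt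
    exact hnone ⟨T, u₀, u, p, t, hT, hsol, hax, hns, hA3, ht, not_le.1 hlt⟩
  classical
  -- the modulus `Φ(A) = k(A)` (any value for `A < 0`, never used)
  let Φ : ℝ → ℝ := fun A => if hA : 0 ≤ A then ((hsel A hA).choose : ℝ) else 0
  refine ⟨Φ, fun T A hT hA u₀ u p hsol hax hns hA3 t ht => ?_⟩
  have hΦ : Φ A = ((hsel A hA).choose : ℝ) := dif_pos hA
  rw [hΦ]
  exact (hsel A hA).choose_spec T u₀ u p t hT hsol hax hns hA3 ht

/-- **An essential supremum above a level is exceeded at a point**: if `c < ‖f‖_{L^∞}` (for a real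
`c ≥ 0`) then `c < ‖f x‖` for some `x` (no regularity needed: otherwise `‖f‖_∞ ≤ c`). -/
theorem exists_point_of_lt_eLpNorm_top {α : Type*} [MeasurableSpace α] {μ : Measure α}
    {F : Type*} [NormedAddCommGroup F] {f : α → F} {c : ℝ}
    (h : ENNReal.ofReal c < eLpNorm f ∞ μ) : ∃ x, c < ‖f x‖ := by
  by_contra hx
  have hle : ∀ x, ‖f x‖ ≤ c := fun x => not_lt.1 fun hcx => hx ⟨x, hcx⟩
  have hbound : eLpNorm f ∞ μ ≤ ENNReal.ofReal c := by
    rw [eLpNorm_exponent_top]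
    exact eLpNormEssSup_le_of_ae_bound (Eventually.of_forall hle)
  exact absurd h (not_lt.2 hbound)

/-- The selection with a POINT: for every `k` a Tao-class swirl-free axisymmetric solution with
`‖u₀‖₃ ≤ A`, a time `t ∈ (0,T)` and a point `x` with `k · t^{-1/2} < ‖u(t, x)‖`. -/
theorem exists_family_points_of_not_critSmoothingNoSwirlB (h : ¬ CritSmoothingNoSwirlB) :
    ∃ A : ℝ, 0 ≤ A ∧ ∀ k : ℕ, ∃ (T : ℝ) (u₀ : E3 → E3) (u : ℝ → E3 → E3) (p : ℝ → E3 → ℝ) (t : ℝ)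
      (x : E3), 0 < T ∧ IsTaoSolutionOn T 1 u₀ u p ∧ IsAxisymmetric u₀ ∧ HasNoSwirl u₀ ∧
      eLpNorm u₀ 3 volume ≤ ENNReal.ofReal A ∧ t ∈ Ioo 0 T ∧
      (k : ℝ) * t ^ (-(1 / 2 : ℝ)) < ‖u t x‖ := by
  obtain ⟨A, hA, hfam⟩ := exists_family_of_not_critSmoothingNoSwirlB h
  refine ⟨A, hA, fun k => ?_⟩
  obtain ⟨T, u₀, u, p, t, hT, hsol, hax, hns, hA3, ht, hlt⟩ := hfam k
  have hk0 : (0 : ℝ) ≤ k := Nat.cast_nonneg k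
  have ht0 : 0 ≤ t ^ (-(1 / 2 : ℝ)) := Real.rpow_nonneg ht.1.le _
  rw [← ENNReal.ofReal_mul hk0] at hlt
  obtain ⟨x, hx⟩ := exists_point_of_lt_eLpNorm_top hlt
  exact ⟨T, u₀, u, p, t, x, hT, hsol, hax, hns, hA3, ht, hx⟩

end Summit.NavierStokesRegularity.NavierStokesRegularity.Theorems.L3TimeExponentPincerCritModulusNoSwirlSelection

end
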